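import Summits.AtomisticToContinuum.Crystallization.Theorems.GappedShellCensusCleanLimitsHaveWindowsCleanChartTSteps1
import Summits.AtomisticToContinuum.Crystallization.Theorems.GappedShellCensusCleanLimitsHaveWindowsCleanChartTSteps5
import Summits.AtomisticToContinuum.Crystallization.Theorems.PalmUnimodularRigidityShellsToBarlowChartTransportSteps6

/-!
# `CleanLimitsHaveWindows` (stmt-AtomisticToContinuum-15932), line `Sketch` — stub K1 (`stub_cleanChart`):
# the transport development re-run on CLEAN charts — copy of `PalmUnimodularRigidityShellsToBarlowChartTransportSteps6`

This file is a mechanical copy of `Theorems/PalmUnimodularRigidityShellsToBarlowChartTransportSteps6.lean` (crux `ShellsToBarlowChart`,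
route `PalmUnimodularRigidity`; original title: Line `develop-the-model-growth-descent` (crux `ShellsToBarlowChart`, stmt-AtomisticToContinuum-9227): the four in-layer transports `I, J, I⁻¹, J⁻¹` and the vertical transport `V` of frames read in integer charts (specifications, inverse identities, apexes) (part 6/7))
in which the chart hypothesis `hch : ∀ z ∈ S, IsZChart S z (ac z) (Pc z) (Ac z) (nb z)` (integer charts with
`1 %` closeness) is replaced by the CLEAN-CHART hypothesis: at every site a labelling of the bonded neighbours
by `fcc3Int`/`hcpInt`, bijective, with bonds among neighbours = label pairs at squared distance `18`, together
with the TRANSFER property across every bond (proved for clean sets at matching radius `1/5` in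
`…CleanChartTransfer`).  The original development uses its metric hypothesis only through the transfer
lemma, so all proofs go through verbatim; declarations live in the sub-namespace `….Clean` and shadow the
originals, the `hch`-free lemmas of the original file are reused, not restated.  All `[folklore]`.
-/

noncomputable section

namespace Summit.AtomisticToContinuum.Crystallization.Theorems.PalmUnimodularRigidityShellsToBarlowChart.Clean

open Literature.Geometry.DiscreteGeometry Literature.MathematicalPhysics.StatisticalMechanics
open Summit.AtomisticToContinuum.Crystallization.Theorems.ShellsToBarlowChartNegative

variable {S : Set (EuclideanSpace ℝ (Fin 3))} {Pc : (EuclideanSpace ℝ (Fin 3)) → Finset (Fin 3 → ℤ)}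
  {nb : (EuclideanSpace ℝ (Fin 3)) → (Fin 3 → ℤ) → (EuclideanSpace ℝ (Fin 3))}

/-- **`J ∘ J⁻¹ = id`** on valid frames in the admissible regime. [folklore] -/
theorem Jstep_JinvStep (hch : ((∀ z ∈ S, (Pc z = fcc3Int ∨ Pc z = hcpInt) ∧ Set.BijOn (nb z) (↑(Pc z) : Set (Fin 3 → ℤ)) {y | y ∈ S ∧ (0 < dist z y ∧ dist z y ≤ 28 / 25)} ∧ (∀ t ∈ Pc z, ∀ t' ∈ Pc z, ((0 < dist (nb z t) (nb z t') ∧ dist (nb z t) (nb z t') ≤ 28 / 25) ↔ sqNormInt (t - t') = 18))) ∧ (∀ x ∈ S, ∀ y ∈ S, (0 < dist x y ∧ dist x y ≤ 28 / 25) → ∀ t ∈ Pc x, ∀ t' ∈ Pc x, ∀ u ∈ Pc y, ∀ u' ∈ Pc y, nb y u = nb x t → nb y u' = nb x t' → sqNormInt (u - u') = sqNormInt (t - t')))) {x : (EuclideanSpace ℝ (Fin 3))} (hx : x ∈ S) {t₁ t₂ : Fin 3 → ℤ} {U : Finset (Fin 3 → ℤ)} (hU : IsFrame (Pc x) t₁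 t₂ U) (hreg : Pc (nb x (-t₂)) = fcc3Int ∨ Pc x = hcpInt ∨ (-zlab Pc nb (nb x (-t₂)) x ∈ Pc (nb x (-t₂)) ∧ -zlab Pc nb (nb x (-t₂)) (nb x (t₁ - t₂)) ∈ Pc (nb x (-t₂)))) : Jstep Pc nb (JinvStep Pc nb ⟨x, t₁, t₂, U⟩) = ⟨x, t₁, t₂, U⟩ := by
  obtain ⟨hyS, -, -, hwx, -, hvK, -, -, -, -, -, -, -, cm, hcmU, -, -, hbu, -, -, hfilt'⟩ :=
    JinvStep_spec hch hx hU hreg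
  have hUP : U ⊆ Pc x := hU.2.2.1
  have hnt₂ : -t₂ ∈ Pc x := hU.2.1 (mem_hexLabels_iff.2 (Or.inr (Or.inr (Or.inr (Or.inr (Or.inl rfl))))))
  have ht12 : t₁ - t₂ ∈ Pc x := hU.2.1 (mem_hexLabels_iff.2 (Or.inr (Or.inr (Or.inr (Or.inr (Or.inr rfl))))))
  have hμ := zlab_spec hch hyS (nb_mem hch hx (hUP hcmU)).1 hbu
  set w := zlab Pc nb (nb x (-t₂)) x with hw_def
  set v := zlab Pc nb (nb x (-t₂)) (nb x (t₁ - t₂)) with hv_def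
  set μ := zlab Pc nb (nb x (-t₂)) (nb x cm) with hμ_def
  set U' := (JinvStep Pc nb ⟨x, t₁, t₂, U⟩).U with hU'_def
  have hI : JinvStep Pc nb ⟨x, t₁, t₂, U⟩ = ⟨nb x (-t₂), v, w, U'⟩ := rfl
  have hf : U'.filter (fun e => sqNormInt (e - w) = 18) = {μ} := hfilt'
  rw [hI]
  simp only [Jstep]
  rw [hwx]
  rw [hf, Finset.image_singleton, hvK, hμ.2, zlab_nb hch hx hnt₂, zlab_nb hch hx ht12,
    zlab_nb hch hx (hUP hcmU), neg_neg, show t₁ - t₂ - -t₂ = t₁ by abel,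
    capWithAny_of_mem_cap hch hx hU hcmU]


/-! ## The vertical step -/

/-- **Polarity at the apex.**  If a site `u = nb x c` is attached to `x` through an upper-cap
label `c` of a valid frame at `x`, and `u` is HCP, then `x` is POLAR at `u` (the label of `x`
at `u` is not symmetric): otherwise the mirror pair touching that label would be two common
neighbours of `x, u` read at `x` at squared distance `48` around the cap label `c`.
[folklore] -/
theorem polar_at_apex (hch : ((∀ z ∈ S, (Pc z = fcc3Int ∨ Pc z = hcpInt) ∧ Set.BijOn (nb z) (↑(Pc z) : Set (Fin 3 → ℤ)) {y | y ∈ S ∧ (0 < dist z y ∧ dist z y ≤ 28 / 25)} ∧ (∀ t ∈ Pc z, ∀ t' ∈ Pc z, ((0 < dist (nb z t) (nb z t') ∧ dist (nb z t) (nb z t') ≤ 28 / 25) ↔ sqNormInt (t - t') = 18))) ∧ (∀ x ∈ S, ∀ y ∈ S, (0 < dist x y ∧ dist x y ≤ 28 / 25) → ∀ t ∈ Pc x, ∀ t' ∈ Pc x, ∀ u ∈ Pc y, ∀ u' ∈ Pc y, nb y u = nb x t → nb y u' = nb x t' → sqNormInt (u - u') = sqNormInt (t - t')))) {x : (EuclideanSpace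 ℝ (Fin 3))} (hx : x ∈ S)
    {t₁ t₂ : Fin 3 → ℤ} {U : Finset (Fin 3 → ℤ)} (hU : IsFrame (Pc x) t₁ t₂ U)
    {c : Fin 3 → ℤ} (hcU : c ∈ U) (hhcp : Pc (nb x c) = hcpInt) :
    -zlab Pc nb (nb x c) x ∉ Pc (nb x c) := by
  intro hneg
  have hcP : c ∈ Pc x := hU.2.2.1 hcU
  have hu := nb_mem hch hx hcP
  have hξ := zlab_spec hch hu.1 hx (bond_symm hu.2)
  set ξ := zlab Pc nb (nb x c) x with hξ_def
  have hξP : ξ ∈ hcpInt := by rw [← hhcp]; exact hξ.1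
  rw [hhcp] at hneg
  obtain ⟨m, hm, n, hn, hξm, hξn, hmn⟩ := exists_mirror_pair_of_equatorial ξ hξP hneg
  have hmP : m ∈ Pc (nb x c) := by rw [hhcp]; exact hm
  have hnP : n ∈ Pc (nb x c) := by rw [hhcp]; exact hn
  -- the two mirror neighbours are common neighbours of `x` and `u`
  have hzm := nb_mem hch hu.1 hmP
  have hzn := nb_mem hch hu.1 hnP
  have hbm : 0 < dist (nb (nb x c) m) x ∧ dist (nb (nb x c) m) x ≤ 28 / 25 := by
    have := (bond_nb_iff hch hu.1 hmP hξ.1).2 (by rw [sqNormInt_sub_comm]; exact hξm)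
    rwa [hξ.2] at this
  have hbn : 0 < dist (nb (nb x c) n) x ∧ dist (nb (nb x c) n) x ≤ 28 / 25 := by
    have := (bond_nb_iff hch hu.1 hnP hξ.1).2 (by rw [sqNormInt_sub_comm]; exact hξn)
    rwa [hξ.2] at this
  -- their labels at `x`
  have ha := zlab_spec hch hx hzm.1 (bond_symm hbm)
  have hb := zlab_spec hch hx hzn.1 (bond_symm hbn)
  set a := zlab Pc nb x (nb (nb x c) m) with ha_def
  set b := zlab Pc nb x (nb (nb x c) n) with hb_def
  -- both touch `c`
  have hac : sqNormInt (a - c) = 18 := by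
    have := (bond_nb_iff hch hx ha.1 hcP).1 (by rw [ha.2]; exact bond_symm hzm.2)
    exact this
  have hbc : sqNormInt (b - c) = 18 := by
    have := (bond_nb_iff hch hx hb.1 hcP).1 (by rw [hb.2]; exact bond_symm hzn.2)
    exact this
  -- transfer `x → u` of the pair: `48`
  have htr := transfer_nb_nb hch hx hu.1 hu.2 ha.1 hb.1 (by rw [ha.2]; exact hzm.2)
    (by rw [hb.2]; exact hzn.2)
  rw [ha.2, hb.2, zlab_nb hch hu.1 hmP, zlab_nb hch hu.1 hnP, hmn] at htr
  exact no_48_around_polar (Pc x) (pattern_cases hch hx) c hcP a ha.1 b hb.1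
    (cap_label_polar_or_fcc (pattern_cases hch hx) hU hcU)
    (by rw [sqNormInt_sub_comm]; exact hac) (by rw [sqNormInt_sub_comm]; exact hbc) htr.symm

/-- **One-sidedness at a common apex.**  Two sites attached to the same site `u` through
upper-cap labels of valid frames are on one side at `u`: their labels at `u` are both symmetric
(FCC) or both polar (HCP). [folklore] -/
theorem onesided_at_apex (hch : ((∀ z ∈ S, (Pc z = fcc3Int ∨ Pc z = hcpInt) ∧ Set.BijOn (nb z) (↑(Pc z) : Set (Fin 3 → ℤ)) {y | y ∈ S ∧ (0 < dist z y ∧ dist z y ≤ 28 / 25)} ∧ (∀ t ∈ Pc z, ∀ t' ∈ Pc z, ((0 < dist (nb z t) (nb z t') ∧ dist (nb z t) (nb z t') ≤ 28 / 25) ↔ sqNormInt (t - t') = 18))) ∧ (∀ x ∈ S, ∀ y ∈ S, (0 < dist x y ∧ dist x y ≤ 28 / 25) → ∀ t ∈ Pc x, ∀ t' ∈ Pc x, ∀ u ∈ Pc y, ∀ u' ∈ Pc y, nb y u = nb x t → nb y u' = nb x t' → sqNormInt (u - u') = sqNormInt (t - t')))) {x x' : (EuclideanSpace ℝ (Fin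 3))}
    (hx : x ∈ S) (hx' : x' ∈ S) {t₁ t₂ t₁' t₂' : Fin 3 → ℤ} {U U' : Finset (Fin 3 → ℤ)}
    (hU : IsFrame (Pc x) t₁ t₂ U) (hU' : IsFrame (Pc x') t₁' t₂' U') {c c' : Fin 3 → ℤ}
    (hcU : c ∈ U) (hcU' : c' ∈ U') (heq : nb x c = nb x' c') :
    (-zlab Pc nb (nb x c) x ∈ Pc (nb x c) ∧ -zlab Pc nb (nb x c) x' ∈ Pc (nb x c)) ∨
      (-zlab Pc nb (nb x c) x ∉ Pc (nb x c) ∧ -zlab Pc nb (nb x c) x' ∉ Pc (nb x c)) := by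
  have hcP : c ∈ Pc x := hU.2.2.1 hcU
  have hcP' : c' ∈ Pc x' := hU'.2.2.1 hcU'
  have hu := nb_mem hch hx hcP
  have hu' := nb_mem hch hx' hcP'
  have hξ := zlab_spec hch hu.1 hx (bond_symm hu.2)
  have hξ' := zlab_spec hch hu.1 hx' (by rw [heq]; exact bond_symm hu'.2)
  rcases pattern_cases hch hu.1 with hF | hH
  · left
    rw [hF] at hξ hξ' ⊢
    exact ⟨neg_mem_fcc3Int _ hξ.1, neg_mem_fcc3Int _ hξ'.1⟩
  · right
    refine ⟨polar_at_apex hch hx hU hcU hH, ?_⟩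
    have := polar_at_apex hch hx' hU' hcU' (by rw [← heq]; exact hH)
    rwa [← heq] at this

end Summit.AtomisticToContinuum.Crystallization.Theorems.PalmUnimodularRigidityShellsToBarlowChart.Clean

end
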